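import Summits.BirchSwinnertonDyer.BirchSwinnertonDyer.Theorems.ManinLocalTwoThreeBracketSturmFiftyTwoTables
import HarnessLib

/-!
# Level 52 by Bracket–Sturm, part 2: the tables of `A`, `B`, `4·f`, the defect certificate to `q⁸⁴`, and `|c| = 1` on `X₀(52)`
# MODULO THE PINNING `hpin`

Cell bsd-f2-manin, route `ManinLocalTwoThree` (crux C2 `ManinOddAtFour`, stmt-BirchSwinnertonDyer-22967; `--supports` helper): an g53's
`ManinLocalTwoThreeBracketSturmFiftyTwo.lean` (`10624a093ab7e40e`) second half verbatim, split by LEAD p1 g24 at the gate's 400-line limit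
(first half = `…BracketSturmFiftyTwoTables`: the optimal curve `52a1`, the `η`-quotients `G1…G4`, the twelve `η`-certificates to depth `85`);
the basis forms `C7…C10` are LEAD's `LevelFiftyTwo.C7…C10` (`…EtaBasisFiftyTwoD/E`, same exponent lists as an g51's basis).  Headline:
`abs_maninConstant_eq_one_fiftyTwo_of_pinning (W) [IsElliptic] [IsGloballyMinimal] (D : ModularParametrizationData W 52) (hpin) (hopt) :
|D.maninConstant| = 1` — the pinning `hpin` is LEAD's `LevelFiftyTwo.f_apply_eq_F52a` (sequel file `…ManinConstantFiftyTwo`).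
HONEST FRAMING: fact-free, standard axioms; nothing here proves C2/C3 for all `N`, Manin's conjecture or BSD.
[cite: Sturm1987, Thm. 1] [cite: CremonaAlgorithms1997, §2.10, Table 3 (52a)] [cite: AgasheRibetStein2006, §§1–2]
-/

set_option autoImplicit false
-- lint-debt: the directory name repeats the summit name (sibling precedent `ManinLocalTwoThreeManinConstantFortyFour.lean`)
set_option linter.dupNamespace false

noncomputable section

open Complex Function
open UpperHalfPlane hiding I
open scoped Manifold MatrixGroups ModularForm
open CongruenceSubgroup PowerSeries
open Literature.NumberTheory.ModularForms
open Literature.NumberTheory.EllipticCurves Literature.NumberTheory.EllipticCurves.ModularForms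

namespace Summit.BirchSwinnertonDyer.BirchSwinnertonDyer.Theorems.ManinLocalTwoThree.BracketSturm.FiftyTwo

open LevelFiftyTwo (rC1 rC2 rC3 rC5 rC7 rC8 rC9 rC10 C1 C2 C3 C5 C7 C8 C9 C10)
open AddPotGoodPrint (isElliptic_52a1 isGloballyMinimal_52a1)

section Tables

/-- Table of `A = −1024G1 − 768C3 + 256C5 − 384C7 + 384C1`. [cite: CremonaAlgorithms1997, §2.10] -/
def aTab : List ℤ :=
  addList 85 (smulList 85 (-1024) eG1) (addList 85 (smulList 85 (-768) eC3) (addList 85 (smulList 85 256 eC5)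
    (addList 85 (smulList 85 (-384) eC7) (smulList 85 384 eC1))))

/-- Table of `B = 112G1 − 160C3 + 48C5 + 13G2 + 32C7 − 32C9 − 14G3 + G4`. [cite: CremonaAlgorithms1997, §2.10] -/
def bTab : List ℤ :=
  addList 85 (smulList 85 112 eG1) (addList 85 (smulList 85 (-160) eC3) (addList 85 (smulList 85 48 eC5)
    (addList 85 (smulList 85 13 eG2) (addList 85 (smulList 85 32 eC7) (addList 85 (smulList 85 (-32) eC9)
      (addList 85 (smulList 85 (-14) eG3) (smulList 85 1 eG4)))))))

/-- Table of `4·f = −4C1 − 4C2 + 4C7 + C8 − 4C9 − C10`. [cite: CremonaAlgorithms1997, Table 3 (52a)] -/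
def c4Tab : List ℤ :=
  addList 85 (smulList 85 (-4) eC1) (addList 85 (smulList 85 (-4) eC2) (addList 85 (smulList 85 4 eC7)
    (addList 85 (smulList 85 1 eC8) (addList 85 (smulList 85 (-4) eC9) (smulList 85 (-1) eC10)))))

/-- KERNEL CHECK: `4·(aₙ(52a1))_{n<85}` IS the pinning combination of the certified tables. [cite: CremonaAlgorithms1997, Table 3 (52a)] -/
theorem smulList_four_cTab : smulList 85 4 cTab = c4Tab := by
  decide +kernel

/-- The form `A ∈ M₂(Γ₀(52))`. [cite: CremonaAlgorithms1997, §2.10] -/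
abbrev formA : ModularForm (Gamma0 52) 2 :=
  ((-1024 : ℤ) : ℂ) • G1 + (((-768 : ℤ) : ℂ) • C3 + (((256 : ℤ) : ℂ) • C5 + (((-384 : ℤ) : ℂ) • C7 + ((384 : ℤ) : ℂ) • C1)))

/-- The form `B ∈ M₂(Γ₀(52))`. [cite: CremonaAlgorithms1997, §2.10] -/
abbrev formB : ModularForm (Gamma0 52) 2 :=
  ((112 : ℤ) : ℂ) • G1 + (((-160 : ℤ) : ℂ) • C3 + (((48 : ℤ) : ℂ) • C5 + (((13 : ℤ) : ℂ) • G2 + (((32 : ℤ) : ℂ) • C7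
    + (((-32 : ℤ) : ℂ) • C9 + (((-14 : ℤ) : ℂ) • G3 + ((1 : ℤ) : ℂ) • G4))))))

/-- The form `4·(pinned newform) = −4C1 − 4C2 + 4C7 + C8 − 4C9 − C10 ∈ M₂(Γ₀(52))`. [cite: AtkinLehner1970, Thm. 5] -/
abbrev formF4 : ModularForm (Gamma0 52) 2 :=
  ((-4 : ℤ) : ℂ) • C1 + (((-4 : ℤ) : ℂ) • C2 + (((4 : ℤ) : ℂ) • C7 + (((1 : ℤ) : ℂ) • C8 + (((-4 : ℤ) : ℂ) • C9
    + ((-1 : ℤ) : ℂ) • C10))))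

/-- **Table of `A`.** [cite: CremonaAlgorithms1997, §2.10] -/
theorem coeff_A : ∀ n < 85, ((aTab.getD n 0 : ℤ) : ℂ) = (qExpansion 1 ⇑formA).coeff n :=
  coeff_eq_addList _ _ (coeff_eq_smulList G1 (-1024) coeff_G1) <| coeff_eq_addList _ _ (coeff_eq_smulList C3 (-768) coeff_C3) <|
    coeff_eq_addList _ _ (coeff_eq_smulList C5 256 coeff_C5) <|
    coeff_eq_addList _ _ (coeff_eq_smulList C7 (-384) coeff_C7) (coeff_eq_smulList C1 384 coeff_C1)

/-- **Table of `B`.** [cite: CremonaAlgorithms1997, §2.10] -/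
theorem coeff_B : ∀ n < 85, ((bTab.getD n 0 : ℤ) : ℂ) = (qExpansion 1 ⇑formB).coeff n :=
  coeff_eq_addList _ _ (coeff_eq_smulList G1 112 coeff_G1) <| coeff_eq_addList _ _ (coeff_eq_smulList C3 (-160) coeff_C3) <|
    coeff_eq_addList _ _ (coeff_eq_smulList C5 48 coeff_C5) <| coeff_eq_addList _ _ (coeff_eq_smulList G2 13 coeff_G2) <|
    coeff_eq_addList _ _ (coeff_eq_smulList C7 32 coeff_C7) <| coeff_eq_addList _ _ (coeff_eq_smulList C9 (-32) coeff_C9) <|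
    coeff_eq_addList _ _ (coeff_eq_smulList G3 (-14) coeff_G3) (coeff_eq_smulList G4 1 coeff_G4)

/-- Table of `formF4`. [cite: Koehler2011, §2.1] -/
theorem coeff_F4 : ∀ n < 85, ((c4Tab.getD n 0 : ℤ) : ℂ) = (qExpansion 1 ⇑formF4).coeff n :=
  coeff_eq_addList _ _ (coeff_eq_smulList C1 (-4) coeff_C1) <| coeff_eq_addList _ _ (coeff_eq_smulList C2 (-4) coeff_C2) <|
    coeff_eq_addList _ _ (coeff_eq_smulList C7 4 coeff_C7) <| coeff_eq_addList _ _ (coeff_eq_smulList C8 1 coeff_C8) <|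
    coeff_eq_addList _ _ (coeff_eq_smulList C9 (-4) coeff_C9) (coeff_eq_smulList C10 (-1) coeff_C10)

/-- DIVISION OF A TABLE BY A NON-ZERO INTEGER: if `m·c` is the table of `m·F` then `c` is the table of `F` (`F` nice).
[folklore] -/
theorem coeff_eq_of_smulList_eq {F : ℍ → ℂ}
    (hF : Periodic (F ∘ ofComplex) 1 ∧ MDifferentiable 𝓘(ℂ) 𝓘(ℂ) F ∧ IsBoundedAtImInfty F) {M : ℕ} {m : ℤ} (hm : m ≠ 0)
    {c c' : List ℤ} (hcc : smulList M m c = c')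
    (hc' : ∀ n < M, ((c'.getD n 0 : ℤ) : ℂ) = (qExpansion 1 ((m : ℂ) • F)).coeff n) :
    ∀ n < M, ((c.getD n 0 : ℤ) : ℂ) = (qExpansion 1 F).coeff n := by
  subst hcc
  intro n hn
  have h := hc' n hn
  rw [QExpansionAlgebra.qExpansion_smul_of_nice one_pos _ hF, map_smul, smul_eq_mul, smulList,
    getD_map_range _ hn, Int.cast_mul] at h
  exact mul_left_cancel₀ (Int.cast_ne_zero.mpr hm) h

variable {W : WeierstrassCurve ℚ}

/-- THE PINNING HYPOTHESIS turned into an equality of functions `4·⇑D.f = ⇑formF4`. [cite: AtkinLehner1970, Thm. 5]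
[cite: DiamondShurman2005, Thm. 3.5.1, §5.8] -/
theorem four_smul_coe_f_eq (P : ModularParametrizationData W 52)
    (hpin : ∀ τ : ℍ, P.f τ = -C1 τ - C2 τ + C7 τ + (1 / 4 : ℂ) * C8 τ - C9 τ - (1 / 4 : ℂ) * C10 τ) :
    ((4 : ℤ) : ℂ) • ⇑P.f = ⇑formF4 := by
  funext τ
  have hs : ∀ (c : ℂ) (G : ModularForm (Gamma0 52) 2) (z : ℍ), (c • G) z = c * G z := fun _ _ _ ↦ rfl
  simp only [Pi.smul_apply, smul_eq_mul, ModularForm.add_apply, hs, hpin τ]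
  push_cast
  ring

/-- **Table of `⇑D.f` to `q⁸⁴` for every PINNED `X₀(52)`-datum** (`η`-certificates + division by `4`).
[cite: AtkinLehner1970, Thm. 5] [cite: CremonaAlgorithms1997, Table 3 (52a)] -/
theorem coeff_f (P : ModularParametrizationData W 52)
    (hpin : ∀ τ : ℍ, P.f τ = -C1 τ - C2 τ + C7 τ + (1 / 4 : ℂ) * C8 τ - C9 τ - (1 / 4 : ℂ) * C10 τ) :
    ∀ n < 85, ((cTab.getD n 0 : ℤ) : ℂ) = (qExpansion 1 ⇑P.f).coeff n :=
  coeff_eq_of_smulList_eq (nice_coe_cuspForm P.f) (by norm_num) smulList_four_cTab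
    (coeff_eq_of_coe_eq (four_smul_coe_f_eq P hpin) coeff_F4)

end Tables

/-! ## §4 The defect certificate -/

/-- **THE BRACKET–STURM CERTIFICATE AT LEVEL 52**: the truncated defect
`216·[a,b]² − c²·(864a³ + 864ab² − 8640b³)·b` vanishes to `q⁸⁴` (kernel evaluation). [cite: Sturm1987, Thm. 1] -/
theorem defectList_eq : defectList 85 (216 : ℤ) 864 (-864) 8640 aTab bTab cTab = List.replicate 85 0 := by
  decide +kernel

/-- `hzero`. [cite: Sturm1987, Thm. 1] -/
theorem hzero : ∀ n < 85, (defectList 85 (216 : ℤ) 864 (-864) 8640 aTab bTab cTab).getD n 0 = 0 :=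
  forall_getD_eq_zero_of_eq_replicate defectList_eq

/-- `hBnz`: `b₃ = 256 ≠ 0`. [folklore] -/
theorem hBnz : ∃ n < 85, bTab.getD n 0 ≠ 0 := ⟨3, by decide, by decide +kernel⟩

/-- `hCnz`: the cubic `864a³ + 864ab² − 8640b³` has a non-zero `q³`-coefficient. [folklore] -/
theorem hCnz : ∃ n < 85, (cubicList 85 (864 : ℤ) (-864) 8640 aTab bTab).getD n 0 ≠ 0 := ⟨3, by decide, by decide +kernel⟩

/-- The Sturm bound in weight `4·2 + 4 = 12` at level `52`: `⌊12·μ₀(52)/12⌋ = 84 < 85`. [cite: Sturm1987, Thm. 1] -/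
theorem sturm_fiftyTwo : ((4 * (2 : ℤ) + 4) * gamma0Index 52).toNat / 12 < 85 := by
  rw [gamma0Index_fiftyTwo]; decide

/-! ## §5 The headline: `|c| = 1`, `2 ∤ c`, `p ∤ c` on `X₀(52)` from the pinning -/

/-- **`|c| = 1` on `X₀(52)` FROM THE PINNING**: for every globally minimal elliptic `W/ℚ` and every `X₀(52)`-parametrisation
datum `D` of `W` with the lattice clause `Λ_W = c·Λ(D.f)` whose newform is pinned as `−C₁ − C₂ + C₇ + ¼C₈ − C₉ − ¼C₁₀`,
`|c(D)| = 1`.  Proof = the Bracket–Sturm headline fed with the twelve `η`-coefficient certificates, the pinning and the defect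
certificate; comparison curve `52a1`, its Néron lattice by uniformisation. [cite: Manin1972, Prop. 1.4] [cite: Sturm1987, Thm. 1]
[cite: AgasheRibetStein2006, §§1–2] [cite: CremonaAlgorithms1997, §2.10] -/
theorem abs_maninConstant_eq_one_fiftyTwo_of_pinning (W : WeierstrassCurve ℚ) [W.IsElliptic] [W.IsGloballyMinimal]
    (D : ModularParametrizationData W 52) (hopt : ∀ z ∈ D.L.lattice, ∃ w ∈ periodLattice D.f, z = D.c * w)
    (hpin : ∀ τ : ℍ, D.f τ = -C1 τ - C2 τ + C7 τ + (1 / 4 : ℂ) * C8 τ - C9 τ - (1 / 4 : ℂ) * C10 τ) :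
    |D.maninConstant| = 1 := by
  haveI := isElliptic_52a1
  haveI := isGloballyMinimal_52a1
  obtain ⟨L₀, h2, h3⟩ := ((⟨0, 0, 0, 1, -10⟩ : WeierstrassCurve ℚ).baseChange ℂ).exists_periodPair_of_isElliptic'
  have hL₀ : IsNeronLatticeOf ((⟨0, 0, 0, 1, -10⟩ : WeierstrassCurve ℚ).baseChange ℂ) L₀ := ⟨h2, h3⟩
  obtain ⟨hc₂, hc₃⟩ := neron_invariants_fiftyTwoA1 hL₀
  exact abs_maninConstant_eq_one_of_defectList_eq_zero (⟨0, 0, 0, 1, -10⟩ : WeierstrassCurve ℚ) L₀ hL₀ W D hopt formA formB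
    sturm_fiftyTwo aTab bTab cTab coeff_A coeff_B (coeff_f D hpin) 216 864 (-864) 8640 (by norm_num) (by norm_num) hc₂ hc₃
    hzero hBnz hCnz

/-- **`2 ∤ c` on `X₀(52)` FROM THE PINNING** — the body of the crux C2 `ManinOddAtFour` at `N = 52` (`2² ∣ 52`) with none of its
fact hypotheses, modulo the pinning. [cite: AgasheRibetStein2006, §§1–2] -/
theorem not_two_dvd_maninConstant_fiftyTwo_of_pinning (W : WeierstrassCurve ℚ) [W.IsElliptic] [W.IsGloballyMinimal]
    (D : ModularParametrizationData W 52) (hopt : ∀ z ∈ D.L.lattice, ∃ w ∈ periodLattice D.f, z = D.c * w)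
    (hpin : ∀ τ : ℍ, D.f τ = -C1 τ - C2 τ + C7 τ + (1 / 4 : ℂ) * C8 τ - C9 τ - (1 / 4 : ℂ) * C10 τ) :
    ¬ (2 : ℤ) ∣ D.maninConstant := by
  have h := abs_maninConstant_eq_one_fiftyTwo_of_pinning W D hopt hpin
  intro h2
  have := Int.le_of_dvd (by rw [h]; norm_num) ((dvd_abs _ _).mpr h2)
  rw [h] at this
  norm_num at this

/-- **No prime divides `c` on `X₀(52)`, FROM THE PINNING** (in particular the `p = 13` case is vacuous-free). [cite: AgasheRibetStein2006, §§1–2] -/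
theorem not_prime_dvd_maninConstant_fiftyTwo_of_pinning (W : WeierstrassCurve ℚ) [W.IsElliptic] [W.IsGloballyMinimal]
    (D : ModularParametrizationData W 52) (hopt : ∀ z ∈ D.L.lattice, ∃ w ∈ periodLattice D.f, z = D.c * w)
    (hpin : ∀ τ : ℍ, D.f τ = -C1 τ - C2 τ + C7 τ + (1 / 4 : ℂ) * C8 τ - C9 τ - (1 / 4 : ℂ) * C10 τ)
    {p : ℕ} (hp : p.Prime) : ¬ (p : ℤ) ∣ D.maninConstant := by
  have h := abs_maninConstant_eq_one_fiftyTwo_of_pinning W D hopt hpin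
  intro hpd
  have h1 := Int.le_of_dvd (by rw [h]; norm_num) ((dvd_abs _ _).mpr hpd)
  rw [h] at h1
  have := hp.two_le
  omega

end Summit.BirchSwinnertonDyer.BirchSwinnertonDyer.Theorems.ManinLocalTwoThree.BracketSturm.FiftyTwo

end
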